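import Summits.QuantumFields.BalabanUV.Beta.GAN24.SpureSlotChargeLevelOne
import Summits.QuantumFields.BalabanUV.Beta.GAN24.EdgePotentialColumnOrthogonal
import Summits.QuantumFields.BalabanUV.Beta.GAN24.WardGammaPlainRowCentred

/-!
# `BalabanUV.Beta.GAN24.SpureSlotChargeLevelOneZero` — binder row G-an2-4 ∕ (CONV-C), the (S) row of RULING R-gan24p1-g27-1 B (viii), the PLAIN sub-row of (W-γ) at level 1:
# **THE LEVEL-1 PURE S TABLE HAS NO PLAIN ff SLOT CHARGE — `hζS` AT `j = 1` HOLDS ON THE WHOLE FIELD–FIELD BLOCK WITH `ζS = 0`**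
# (G-an2-4 formalisation swarm → CRUX TEAM (2), leaf prover `b2b-balaban-gan24-formalise-leaf-02`, gen 56, PART 4)

NOT IN PRINT; OUR BOOKKEEPING ([folklore] assembly BY NAME of: leaf-02 g56 PART 3 `SpureSlotChargeLevelOne.tsum_prod_spureRecAt_one_inl_inl_eq ∕ _self` (the level-1 plain ff slot charge =
the Maxwell read of g55's face form against the ℋ-column of `G_0`), leaf-06 g46's `EdgePotentialColumnOrthogonal.tsum_curvAdj_curv_mul_colH_eq_zero` (every bounded `Lc`-periodic 1-form
is `(d*d)`-orthogonal to every ℋ-column of `G_0` — the relative-inverse Ward pairing at the identity source, hard-axial representative, vanishing `mm` column mass), leaf-06's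
`EdgePlaquettePotential.curvAdj_curv_edgePotential ∕ wedge_blk_eq ∕ abs_edgePotential_le_one ∕ edgePotential_add_zsmul`, leaf-02 g55 `FaceChargeCurlResummation.curv_faceForm`,
the Literature bound `ResolventComposition.abs_curvAdj_le` ∕ `KKTFluctuationEnergy.abs_curv_le`, leaf-06's `RelInvWardPairing.summable_bdd_mul`; 0 `def`, 0 cited fact, 0 `def … : Prop`, 0 sorry).
HONEST FRAMING (cell contract, verbatim): «discharging `BetaPertH` makes Bałaban's UV stability UNCONDITIONAL — a real constructive-QFT result; it is NOT the continuum limit and NOT the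
Clay problem.»  HONEST DEPENDENCY (verbatim): «continuum YM on T⁴ ⇐ BetaPertH ∧ nine spine estimates (0/9 proved); BetaPertH ⇐ (D1) ∧ (D4) ∧ CAP+tail; G-an2-4 gates asym, D1 and NE2/3/4.»

* §1 **`curvAdj_curv_faceForm_eq_two_mul`**: `curvAdj (curv m_αβ) = 2·curvAdj (curv m̃_αβ)` (`α ≠ β`, `1 ≤ Lc`) — g55's face form (`curv m_αβ = 2·E_αβ·𝟙^{exit}_α𝟙^{exit}_β`,
  `curv_faceForm ⨾ wedge_blk_eq`) and leaf-06's bounded periodic edge potential (`curvAdj (curv m̃_αβ) = curvAdj (E_αβ·𝟙𝟙)`, `curvAdj_curv_edgePotential`) have proportional `(d*d)`-images;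
  `abs_curvAdj_curv_edgePotential_le` (a bound), `summable_colH_mul_curvAdj_curv_edgePotential` (ℋ-column × that image is summable).
* §2 **`tsum_colH_mul_curvAdj_curv_faceForm_eq_zero`**: `Σ_κ Σ'_t colH G_0 Lc κ′ u′ κ t·(cE·(−¼·curvAdj (curv m_αβ) κ t)) = 0` for `α ≠ β` (§1 ⨾ leaf-06's orthogonality), and the END
  **`tsum_prod_spureRecAt_one_inl_inl_eq_zero`** ∕ **`hasSum_prod_spureRecAt_one_inl_inl`**: for an in-block root, EVERY `cE cVH cΛ`, EVERY slot `(κ′,u′)` and EVERY ff channel `(α,β)`,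
  `Σ'_{(x,z)} SpureRecAt d Lc (toSite r) cE cVH cΛ 1 κ′ u′ x z (inl α)(inl β) = 0` — road-P2's `hζS` at `j = 1` on the ff block, `ζS = 0` (PREDICTION P-leaf02-g56-1 of l.44489, now a theorem;
  `α = β` is PART 3's `_self`).
* §3 THE CONSUMER (road-P2's `WardGammaPlainRowCentred.hasSum_comb_gaugeCharge_plain_ctr` with `ζS := 0`): **`hasSum_comb_gaugeCharge_plain_ctr_zero_inl_inl`** and
  **`hasSum_comb_gaugeCharge_plain_ctr_one_inl_inl`** — at Bałaban's centre (`Lc` odd) the PLAIN ff charge of the (γ) comb letter VANISHES per slot at levels `j = 0` and `j = 1`,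
  every label `y`, slot `(ν,y′)`, channel `(inl α, inl β)`, every `cE cVH cΛ` (PART 1 ∕ this file feed `hζS`; (T-F) and the `M1` closed form are road-P2's, BY NAME).
READING.  Levels 0 AND 1 of the pure S table carry NO plain ff slot charge at all (PART 1 + this file); with road-P2's (T-F) the plain ff sub-row of (W-γ) at `j ∈ {0, 1}` therefore reads
`0 = 0` per slot.  Level `j+1 ≥ 2` needs the exit⊗exit slot-charge function of `SrecAt (j ≥ 1)` (PART 3 §1's reduction) — an exit-weighted `mm`-sandwich one level down; not here.
Asserts NO value of any column of `G_0` beyond leaf-06's orthogonality; NOTHING of (W-γ)'s exit sub-row ∕ (INV) ∕ (S) ∕ (Q-R) ∕ (LT) ∕ (Q-L) ∕ (C) ∕ «T2Shape» ∕ (hW, hWall) discharged;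
NEVER «G-an2-4 closed» as (CONV-C); NOT D1, NOT `BetaPertH`, NOT continuum, NOT Clay.  2026-08-22; no existing file touched.
-/

noncomputable section

open Finset
open scoped BigOperators
open Literature.MathematicalPhysics.QuantumFieldTheory
open Literature.MathematicalPhysics.QuantumFieldTheory.Balaban1983to89
open Literature.MathematicalPhysics.QuantumFieldTheory.Balaban1983to89.Beta
open B12Sec2to5 (l1)
open ExpKernelCalculus (Site MKer Decays summable_exp_shift')
open OneStepResolventKernel (Fib)
open OneStepKernelFamily (KInvStep colH abs_colH_le)
open AffineAveraging (Form1 Form2 box toSite unitVec unitVec_apply dz curv curvAdj)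
open BalabanStepJetsSucc (wE)
open ResolventComposition (abs_curvAdj_le)
open Summit.QuantumFields.BalabanUV.Beta.AxialDressingRooted (coDressKBmAt decays_coDressKBmAt_KInvStep)
open Summit.QuantumFields.BalabanUV.Beta.SpineRooted (SpureRecAt)
open Summit.QuantumFields.BalabanUV.Beta.GAN24.FaceChargeCurlResummation (curv_faceForm)
open Summit.QuantumFields.BalabanUV.Beta.GAN24.EdgePlaquettePotential (curvAdj_curv_edgePotential wedge_blk_eq abs_edgePotential_le_one edgePotential_add_zsmul)
open Summit.QuantumFields.BalabanUV.Beta.GAN24.RelInvWardPairing (summable_bdd_mul)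
open Summit.QuantumFields.BalabanUV.Beta.GAN24.EdgePotentialColumnOrthogonal (tsum_curvAdj_curv_mul_colH_eq_zero)
open Summit.QuantumFields.BalabanUV.Beta.GAN24.SpureSlotChargeLevelOne (tsum_prod_spureRecAt_one_inl_inl_eq tsum_prod_spureRecAt_one_inl_inl_self
  hasSum_prod_spureRecAt_succ_inl_inl_colH)
open Summit.QuantumFields.BalabanUV.Beta.GAN24.SpureSlotChargeLevelZero (tsum_prod_spureRecAt_zero_inl_inl)
open Summit.QuantumFields.BalabanUV.Beta.GAN24.WardGammaPlainRowCentred (hasSum_comb_gaugeCharge_plain_ctr)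
open AveragingContoursRooted (ctrOff ctrOff_mem_box)
open AveragingContours (blk)
open OneStepResolventKernel (wsum)
open ExpKernelCalculus (comp)
open SecondOrderResponse (dM)
open InterLevelTransport (cwsum)
open BalabanStepJetsSucc (wVH)
open Summit.QuantumFields.BalabanUV.Beta.BorderedHessian (stepScale)
open Summit.QuantumFields.BalabanUV.Beta.SpineRooted (M1At)
open Summit.QuantumFields.BalabanUV.Beta.KernelWardRelative (gaugeWt)

namespace Summit.QuantumFields.BalabanUV.Beta.GAN24.SpureSlotChargeLevelOneZero

variable {d : ℕ}

/-! ## §1 The face form and the edge potential have proportional `(d*d)`-images -/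

/-- NOT IN PRINT; OUR BOOKKEEPING.  **`(d*d) m_αβ = 2·(d*d) m̃_αβ`** (`α ≠ β`, `1 ≤ L`): g55's face form `m_αβ β′ z = dzψ_β β′ z·(ψ_α z + ψ_α(z+e_{β′}))` has `curv m_αβ = 2·E_αβ·𝟙^{exit}_α𝟙^{exit}_β`
(`curv_faceForm ⨾ wedge_blk_eq`), leaf-06's bounded periodic edge potential has `curvAdj (curv m̃_αβ) = curvAdj (E_αβ·𝟙^{exit}_α𝟙^{exit}_β)` (`curvAdj_curv_edgePotential`). -/
theorem curvAdj_curv_faceForm_eq_two_mul {L : ℕ} (hL : 1 ≤ L) {a b : Fin (d + 1)} (hab : a ≠ b) (μ : Fin (d + 1)) (y : Fin (d + 1) → ℤ) :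
    curvAdj (curv (fun β' z => dz (fun w : Fin (d + 1) → ℤ => ((w b / (L : ℤ) : ℤ) : ℝ)) β' z
        * ((((z a / (L : ℤ) : ℤ) : ℝ)) + (((z + B6BondElimination.unitVec β') a / (L : ℤ) : ℤ) : ℝ)))) μ y
      = 2 * curvAdj (curv (fun β z => ((L : ℝ) ^ 2)⁻¹ * ((((z + unitVec β) b % (L : ℤ) : ℤ)) : ℝ) * dz (fun w : Fin (d + 1) → ℤ => ((w a : ℤ) : ℝ)) β z
          - (L : ℝ)⁻¹ * (((z a % (L : ℤ) : ℤ)) : ℝ) * dz (fun w : Fin (d + 1) → ℤ => (((w b / (L : ℤ) : ℤ)) : ℝ)) β z)) μ y := by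
  rw [curvAdj_curv_edgePotential hL hab]
  have e : curv (fun β' z => dz (fun w : Fin (d + 1) → ℤ => ((w b / (L : ℤ) : ℤ) : ℝ)) β' z
        * ((((z a / (L : ℤ) : ℤ) : ℝ)) + (((z + B6BondElimination.unitVec β') a / (L : ℤ) : ℤ) : ℝ)))
      = fun κ l x => 2 * (((if κ = a ∧ l = b then (1 : ℝ) else 0) - (if κ = b ∧ l = a then (1 : ℝ) else 0))
          * ((if x a % (L : ℤ) = (L : ℤ) - 1 then (1 : ℝ) else 0) * (if x b % (L : ℤ) = (L : ℤ) - 1 then (1 : ℝ) else 0))) := by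
    funext κ l x
    rw [curv_faceForm hab, wedge_blk_eq hL hab]
  rw [e]
  simp only [AffineAveraging.curvAdj, Finset.mul_sum, mul_add, mul_sub]

/-- [folklore] `(d*d) m̃_αβ` is bounded (by `8(d+1)`): `curv m̃_αβ = E·(𝟙𝟙 − L⁻²)` has `|·| ≤ … `; we only use `|m̃| ≤ 1 ⇒ |curv m̃| ≤ 4 ⇒ |curvAdj (curv m̃)| ≤ (d+1)·8 + (d+1)·8`. -/
theorem abs_curvAdj_curv_edgePotential_le {L : ℕ} (hL : 1 ≤ L) {a b : Fin (d + 1)} (hab : a ≠ b) (μ : Fin (d + 1)) (y : Fin (d + 1) → ℤ) :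
    |curvAdj (curv (fun β z => ((L : ℝ) ^ 2)⁻¹ * ((((z + unitVec β) b % (L : ℤ) : ℤ)) : ℝ) * dz (fun w : Fin (d + 1) → ℤ => ((w a : ℤ) : ℝ)) β z
          - (L : ℝ)⁻¹ * (((z a % (L : ℤ) : ℤ)) : ℝ) * dz (fun w : Fin (d + 1) → ℤ => (((w b / (L : ℤ) : ℤ)) : ℝ)) β z)) μ y|
      ≤ ((d + 1 : ℕ) : ℝ) * (2 * 4) + ((d + 1 : ℕ) : ℝ) * (2 * 4) := by
  have hB := abs_edgePotential_le_one (d := d) hL hab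
  have hc : ∀ κ l x, |curv (fun β z => ((L : ℝ) ^ 2)⁻¹ * ((((z + unitVec β) b % (L : ℤ) : ℤ)) : ℝ) * dz (fun w : Fin (d + 1) → ℤ => ((w a : ℤ) : ℝ)) β z
      - (L : ℝ)⁻¹ * (((z a % (L : ℤ) : ℤ)) : ℝ) * dz (fun w : Fin (d + 1) → ℤ => (((w b / (L : ℤ) : ℤ)) : ℝ)) β z) κ l x| ≤ 4 := by
    intro κ l x
    have h := KKTFluctuationEnergy.abs_curv_le (M := 1) hB κ l x
    linarith
  have h := abs_curvAdj_le (D := d + 1) hc μ y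
  simpa using h

/-- [folklore] **THE ℋ-COLUMN OF `G_0` TIMES `(d*d) m̃_αβ` IS SUMMABLE** over the slots of one direction (decaying column × bounded form). -/
theorem summable_colH_mul_curvAdj_curv_edgePotential {Lc : ℕ} [NeZero Lc] (hLc : 1 ≤ Lc) {r : Fin (d + 1) → ℕ} (hr : r ∈ box (d + 1) Lc)
    {a b : Fin (d + 1)} (hab : a ≠ b) (κ' : Fin (d + 1)) (u' : Site (d + 1)) (κ : Fin (d + 1)) :
    Summable fun t : Site (d + 1) => colH (coDressKBmAt (toSite r) Lc (KInvStep (d := d) Lc 0)) Lc κ' u' κ t *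
      curvAdj (curv (fun β z => ((Lc : ℝ) ^ 2)⁻¹ * ((((z + unitVec β) b % (Lc : ℤ) : ℤ)) : ℝ) * dz (fun w : Fin (d + 1) → ℤ => ((w a : ℤ) : ℝ)) β z
          - (Lc : ℝ)⁻¹ * (((z a % (Lc : ℤ) : ℤ)) : ℝ) * dz (fun w : Fin (d + 1) → ℤ => (((w b / (Lc : ℤ) : ℤ)) : ℝ)) β z)) κ t := by
  obtain ⟨δ, C, hδ, -, hG⟩ := decays_coDressKBmAt_KInvStep (d := d) hr 0
  have hcol : Summable fun t : Site (d + 1) => |colH (coDressKBmAt (toSite r) Lc (KInvStep (d := d) Lc 0)) Lc κ' u' κ t| :=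
    Summable.of_nonneg_of_le (fun _ => abs_nonneg _) (fun t => abs_colH_le hG κ' u' κ t) ((summable_exp_shift' hδ _).mul_left C)
  have h := summable_bdd_mul (fun t => abs_curvAdj_curv_edgePotential_le hLc hab κ t) hcol
  exact h.congr fun t => mul_comm _ _

/-! ## §2 The level-1 plain ff slot charge vanishes -/

/-- NOT IN PRINT; OUR BOOKKEEPING.  **THE MAXWELL READ OF THE FACE FORM AGAINST THE ℋ-COLUMN OF `G_0` VANISHES** (`α ≠ β`, in-block root, every slot `(κ′,u′)`, every `cE`):
`Σ_κ Σ'_t colH G_0 Lc κ′ u′ κ t·(cE·(−¼·curvAdj (curv m_αβ) κ t)) = 0` — §1's proportionality + leaf-06's `tsum_curvAdj_curv_mul_colH_eq_zero` for the bounded `Lc`-periodic edge potential. -/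
theorem tsum_colH_mul_curvAdj_curv_faceForm_eq_zero {Lc : ℕ} [NeZero Lc] {r : Fin (d + 1) → ℕ} (hr : r ∈ box (d + 1) Lc) (cE : ℝ)
    (κ' : Fin (d + 1)) (u' : Site (d + 1)) {α β : Fin (d + 1)} (hαβ : α ≠ β) :
    ∑ κ : Fin (d + 1), ∑' t : Site (d + 1), colH (coDressKBmAt (toSite r) Lc (KInvStep (d := d) Lc 0)) Lc κ' u' κ t *
        (cE * (-(1 / 4 : ℝ) * curvAdj (curv (fun β' z => dz (fun w : Fin (d + 1) → ℤ => ((w β / (Lc : ℤ) : ℤ) : ℝ)) β' z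
          * ((((z α / (Lc : ℤ) : ℤ) : ℝ)) + (((z + B6BondElimination.unitVec β') α / (Lc : ℤ) : ℤ) : ℝ)))) κ t)) = 0 := by
  have hLc : 1 ≤ Lc := Nat.one_le_iff_ne_zero.2 (NeZero.ne Lc)
  -- the orthogonality of leaf-06, for the edge potential `m̃_αβ`
  have horth := tsum_curvAdj_curv_mul_colH_eq_zero (d := d) hr (B := 1) (fun κ u => abs_edgePotential_le_one hLc hαβ κ u)
    (fun κ x v => edgePotential_add_zsmul hLc hαβ κ x v) κ' u'
  -- rewrite the face form's `(d*d)`-image and pull the constants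
  simp only [curvAdj_curv_faceForm_eq_two_mul hLc hαβ]
  have hs := fun κ => summable_colH_mul_curvAdj_curv_edgePotential hLc hr hαβ κ' u' κ
  have e : ∀ (κ : Fin (d + 1)) (t : Site (d + 1)),
      colH (coDressKBmAt (toSite r) Lc (KInvStep (d := d) Lc 0)) Lc κ' u' κ t *
          (cE * (-(1 / 4 : ℝ) * (2 * curvAdj (curv (fun β' z => ((Lc : ℝ) ^ 2)⁻¹ * ((((z + unitVec β') β % (Lc : ℤ) : ℤ)) : ℝ)
              * dz (fun w : Fin (d + 1) → ℤ => ((w α : ℤ) : ℝ)) β' z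
            - (Lc : ℝ)⁻¹ * (((z α % (Lc : ℤ) : ℤ)) : ℝ) * dz (fun w : Fin (d + 1) → ℤ => (((w β / (Lc : ℤ) : ℤ)) : ℝ)) β' z)) κ t)))
        = (cE * (-(1 / 2 : ℝ))) * (curvAdj (curv (fun β' z => ((Lc : ℝ) ^ 2)⁻¹ * ((((z + unitVec β') β % (Lc : ℤ) : ℤ)) : ℝ)
              * dz (fun w : Fin (d + 1) → ℤ => ((w α : ℤ) : ℝ)) β' z
            - (Lc : ℝ)⁻¹ * (((z α % (Lc : ℤ) : ℤ)) : ℝ) * dz (fun w : Fin (d + 1) → ℤ => (((w β / (Lc : ℤ) : ℤ)) : ℝ)) β' z)) κ t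
            * colH (coDressKBmAt (toSite r) Lc (KInvStep (d := d) Lc 0)) Lc κ' u' κ t) := fun κ t => by ring
  simp only [e, tsum_mul_left]
  rw [← Finset.mul_sum, ← Summable.tsum_finsetSum (fun κ _ => (hs κ).congr fun t => mul_comm _ _)]
  rw [horth, mul_zero]

/-- NOT IN PRINT; OUR BOOKKEEPING.  **THE LEVEL-1 PURE S TABLE HAS NO PLAIN ff SLOT CHARGE** (in-block root `ρ = toSite r`, `Lc ≥ 1`, EVERY `cE cVH cΛ`, EVERY slot `(κ′,u′)`, EVERY ff channel `(α,β)`):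
`Σ'_{(x,z)} SpureRecAt d Lc ρ cE cVH cΛ 1 κ′ u′ x z (inl α)(inl β) = 0` — road-P2's displayed `hζS` at `j = 1` on the field–field block HOLDS with `ζS = 0`.  `α = β`: PART 3's `_self`
(the Wilson letter's same-direction exit⊗exit charge is a `d*d` of an exact form); `α ≠ β`: PART 3's Maxwell read ⨾ §2. -/
theorem tsum_prod_spureRecAt_one_inl_inl_eq_zero {Lc : ℕ} [NeZero Lc] {r : Fin (d + 1) → ℕ} (hr : r ∈ box (d + 1) Lc) (cE cVH cΛ : ℝ)
    (κ' : Fin (d + 1)) (u' : Site (d + 1)) (α β : Fin (d + 1)) :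
    ∑' xz : Site (d + 1) × Site (d + 1), SpureRecAt d Lc (toSite r) cE cVH cΛ 1 κ' u' xz.1 xz.2 (Sum.inl α) (Sum.inl β) = 0 := by
  by_cases hαβ : α = β
  · subst hαβ
    exact tsum_prod_spureRecAt_one_inl_inl_self hr cE cVH cΛ κ' u' α
  · rw [tsum_prod_spureRecAt_one_inl_inl_eq hr cE cVH cΛ κ' u' α β, tsum_colH_mul_curvAdj_curv_faceForm_eq_zero hr cE κ' u' hαβ]
    simp only [mul_zero]

/-- NOT IN PRINT; OUR BOOKKEEPING.  The `HasSum` form: road-P2's `hζS` at `j = 1`, every ff channel, value `0`. -/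
theorem hasSum_prod_spureRecAt_one_inl_inl {Lc : ℕ} [NeZero Lc] {r : Fin (d + 1) → ℕ} (hr : r ∈ box (d + 1) Lc) (cE cVH cΛ : ℝ)
    (κ' : Fin (d + 1)) (u' : Site (d + 1)) (α β : Fin (d + 1)) :
    HasSum (fun xz : Site (d + 1) × Site (d + 1) => SpureRecAt d Lc (toSite r) cE cVH cΛ 1 κ' u' xz.1 xz.2 (Sum.inl α) (Sum.inl β)) 0 := by
  rw [← tsum_prod_spureRecAt_one_inl_inl_eq_zero hr cE cVH cΛ κ' u' α β]
  exact (hasSum_prod_spureRecAt_succ_inl_inl_colH hr cE cVH cΛ 0 κ' u' α β).summable.hasSum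

/-- NOT IN PRINT; OUR BOOKKEEPING.  **`hζS` AT `j = 1` IN ROAD-P2's LITERAL SHAPE** (`∀ κ u, Σ'_{xz} … = ζS κ` with `ζS ≡ 0`), every ff channel. -/
theorem slotConst_spureRecAt_one_inl_inl {Lc : ℕ} [NeZero Lc] {r : Fin (d + 1) → ℕ} (hr : r ∈ box (d + 1) Lc) (cE cVH cΛ : ℝ) (α β : Fin (d + 1)) :
    ∀ (κ : Fin (d + 1)) (u : Site (d + 1)),
      ∑' xz : Site (d + 1) × Site (d + 1), SpureRecAt d Lc (toSite r) cE cVH cΛ 1 κ u xz.1 xz.2 (Sum.inl α) (Sum.inl β) = (fun _ : Fin (d + 1) => (0 : ℝ)) κ :=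
  fun κ u => tsum_prod_spureRecAt_one_inl_inl_eq_zero hr cE cVH cΛ κ u α β

/-! ## §3 The consumer: the plain ff charge of the (γ) comb letter vanishes per slot at levels 0 and 1 -/

/-- NOT IN PRINT; OUR BOOKKEEPING.  **LEVEL 0: THE PLAIN ff CHARGE OF THE (γ) COMB LETTER VANISHES PER SLOT** (Bałaban's centre, `Lc` odd; every `cE cVH cΛ`, label `y`, slot `(ν,y′)`,
channel `(inl α, inl β)`): road-P2's `hasSum_comb_gaugeCharge_plain_ctr` at `j = 0` fed with PART 1's `hζS` (`ζS ≡ 0`). -/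
theorem hasSum_comb_gaugeCharge_plain_ctr_zero_inl_inl {Lc : ℕ} [NeZero Lc] (hodd : Odd Lc) (cE cVH cΛ : ℝ) (y : Site (d + 1)) (ν : Fin (d + 1)) (y' : Site (d + 1))
    (α β : Fin (d + 1)) :
    HasSum (fun xz : Site (d + 1) × Site (d + 1) =>
        (∑ κ, wsum (fun u => ∑' x₂, ∑ κ₂,
              comp (coDressKBmAt (toSite (ctrOff (d + 1) Lc)) Lc (KInvStep (d := d) Lc 0))
                (dM (coDressKBmAt (toSite (ctrOff (d + 1) Lc)) Lc (KInvStep (d := d) Lc 0)) Lc (SpureRecAt d Lc (toSite (ctrOff (d + 1) Lc)) cE cVH cΛ 0)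
                  (M1At d Lc (toSite (ctrOff (d + 1) Lc)) cΛ 0) ν y')
                u x₂ (Sum.inl κ) (Sum.inl κ₂) * gaugeWt Lc y κ₂ x₂) (SpureRecAt d Lc (toSite (ctrOff (d + 1) Lc)) cE cVH cΛ 0 κ)
          + ∑ ρ', cwsum Lc (fun w => ∑' x₂, ∑ κ₂,
              comp (coDressKBmAt (toSite (ctrOff (d + 1) Lc)) Lc (KInvStep (d := d) Lc 0))
                (dM (coDressKBmAt (toSite (ctrOff (d + 1) Lc)) Lc (KInvStep (d := d) Lc 0)) Lc (SpureRecAt d Lc (toSite (ctrOff (d + 1) Lc)) cE cVH cΛ 0)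
                  (M1At d Lc (toSite (ctrOff (d + 1) Lc)) cΛ 0) ν y')
                ((Lc : ℤ) • w) x₂ (Sum.inr ρ') (Sum.inl κ₂) * gaugeWt Lc y κ₂ x₂) (M1At d Lc (toSite (ctrOff (d + 1) Lc)) cΛ 0 ρ')) xz.1 xz.2 (Sum.inl α) (Sum.inl β))
      0 := by
  have hLc : 1 ≤ Lc := Nat.one_le_iff_ne_zero.mpr (NeZero.ne Lc)
  have h := hasSum_comb_gaugeCharge_plain_ctr (d := d) hodd cE cVH cΛ 0 y ν y' (Sum.inl α) (Sum.inl β) (ζS := fun _ => (0 : ℝ))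
    (fun κ u => tsum_prod_spureRecAt_zero_inl_inl hLc (ctrOff_mem_box hLc) cE cVH cΛ κ u α β)
  simp only [mul_zero, Finset.sum_const_zero] at h
  exact h

/-- NOT IN PRINT; OUR BOOKKEEPING.  **LEVEL 1: THE PLAIN ff CHARGE OF THE (γ) COMB LETTER VANISHES PER SLOT** (Bałaban's centre, `Lc` odd; every `cE cVH cΛ`, label `y`, slot `(ν,y′)`,
channel `(inl α, inl β)`): road-P2's `hasSum_comb_gaugeCharge_plain_ctr` at `j = 1` fed with §2's `hζS` (`ζS ≡ 0`). -/
theorem hasSum_comb_gaugeCharge_plain_ctr_one_inl_inl {Lc : ℕ} [NeZero Lc] (hodd : Odd Lc) (cE cVH cΛ : ℝ) (y : Site (d + 1)) (ν : Fin (d + 1)) (y' : Site (d + 1))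
    (α β : Fin (d + 1)) :
    HasSum (fun xz : Site (d + 1) × Site (d + 1) =>
        (∑ κ, wsum (fun u => ∑' x₂, ∑ κ₂,
              comp (coDressKBmAt (toSite (ctrOff (d + 1) Lc)) Lc (KInvStep (d := d) Lc 1))
                (dM (coDressKBmAt (toSite (ctrOff (d + 1) Lc)) Lc (KInvStep (d := d) Lc 1)) Lc (SpureRecAt d Lc (toSite (ctrOff (d + 1) Lc)) cE cVH cΛ 1)
                  (M1At d Lc (toSite (ctrOff (d + 1) Lc)) cΛ 1) ν y')
                u x₂ (Sum.inl κ) (Sum.inl κ₂) * gaugeWt Lc y κ₂ x₂) (SpureRecAt d Lc (toSite (ctrOff (d + 1) Lc)) cE cVH cΛ 1 κ)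
          + ∑ ρ', cwsum Lc (fun w => ∑' x₂, ∑ κ₂,
              comp (coDressKBmAt (toSite (ctrOff (d + 1) Lc)) Lc (KInvStep (d := d) Lc 1))
                (dM (coDressKBmAt (toSite (ctrOff (d + 1) Lc)) Lc (KInvStep (d := d) Lc 1)) Lc (SpureRecAt d Lc (toSite (ctrOff (d + 1) Lc)) cE cVH cΛ 1)
                  (M1At d Lc (toSite (ctrOff (d + 1) Lc)) cΛ 1) ν y')
                ((Lc : ℤ) • w) x₂ (Sum.inr ρ') (Sum.inl κ₂) * gaugeWt Lc y κ₂ x₂) (M1At d Lc (toSite (ctrOff (d + 1) Lc)) cΛ 1 ρ')) xz.1 xz.2 (Sum.inl α) (Sum.inl β))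
      0 := by
  have hLc : 1 ≤ Lc := Nat.one_le_iff_ne_zero.mpr (NeZero.ne Lc)
  have h := hasSum_comb_gaugeCharge_plain_ctr (d := d) hodd cE cVH cΛ 1 y ν y' (Sum.inl α) (Sum.inl β) (ζS := fun _ => (0 : ℝ))
    (fun κ u => tsum_prod_spureRecAt_one_inl_inl_eq_zero (ctrOff_mem_box hLc) cE cVH cΛ κ u α β)
  simp only [mul_zero, Finset.sum_const_zero] at h
  exact h

end Summit.QuantumFields.BalabanUV.Beta.GAN24.SpureSlotChargeLevelOneZero

end
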